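import Summits.SmoothPoincare4.SmoothPoincare4.Theorems.CylinderEntropyCylinderRungTwoKillingFluxDefs
import Literature.Geometry.Riemannian.KarpukhinSternHarmonicMapsProofs
import HarnessLib

/-!
# Route `CylinderEntropy`, crux `CylinderRungTwo` (stmt-SmoothPoincare4-7631), line `killing-flux`:
# a connected cross-section with horizontal tangent planes has constant height
# (registered helper `helper_heightConstOfHorizontal`, rigidity layer R1-A)

For a connected `4`-manifold `M`, a smooth map `f : M → ℝ⁶` and a unit normal field `ν` along `f`
(`‖ν x‖ = 1` and `ν x ⊥ df_x(T_x M)`, typed `(euclideanMetric ℝ⁶).IsUnitNormal (𝓡 4) f ν 1`) whose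
tangent planes are everywhere HORIZONTAL, `ν₅(x)² = 1` for all `x`, the height `x ↦ f(x)₅` is constant
on `M`.  This is the pointwise core of the rigidity layer of the line ("only the slices `S⁴ × {c}` of
`N = S⁴ × ℝ` are horizontal cross-sections"); no hypothesis `f(M) ⊂ N` is needed.

Proof.
1. `‖ν x‖² = ∑ⱼ νⱼ(x)² = 1` together with `ν₅(x)² = 1` forces `νᵢ(x) = 0` for `i < 5` (a vanishing
   sum of squares): `normal_castSucc_eq_zero_of_sq_eq_one`.
2. Normality `⟪ν x, df_x v⟫ = 0` then reads `ν₅(x) · (df_x v)₅ = 0`, and `ν₅(x) ≠ 0`, so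
   `(df_x v)₅ = 0` for every tangent vector `v`: `mfderiv_apply_five_eq_zero_of_sq_eq_one`.
3. Hence the smooth real function `h = z₅ ∘ f = e₅^* ∘ f` has `dh_x = e₅^* ∘ df_x = 0` everywhere
   (chain rule), and a `C¹` function with vanishing differential on a connected manifold is constant
   (tree `KarpukhinStern.apply_eq_of_mfderiv_eq_zero`: the mean value theorem in charts, then
   connectedness): `helper_heightConstOfHorizontal`.

Everything here is PROVED (no `sorry`, no new definitions, no named facts).
-/

-- the prescribed namespace `Summit.SmoothPoincare4.SmoothPoincare4.…` repeats `SmoothPoincare4`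
set_option linter.dupNamespace false

noncomputable section

open scoped Manifold ContDiff RealInnerProductSpace BigOperators

namespace Summit.SmoothPoincare4.SmoothPoincare4.Cruxes.CylinderRungTwo.KillingFlux

open Literature.Geometry.Riemannian
open Literature.Geometry.Lorentzian Literature.Geometry.Lorentzian.PseudoRiemannianMetric

/-! ### Horizontal unit normals -/

/-- **A horizontal unit normal is `± e₅`.** If `ν` is a unit normal field along `f : M → ℝ⁶`
(Euclidean metric, sign `+1`) and `ν₅(x)² = 1`, then `νᵢ(x) = 0` for every `i < 5`:
`∑ⱼ νⱼ(x)² = ‖ν x‖² = 1 = ν₅(x)²`, so the non-negative squares `νᵢ(x)²`, `i < 5`, sum to zero.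
[folklore] -/
theorem normal_castSucc_eq_zero_of_sq_eq_one {M : Type*} [TopologicalSpace M]
    [ChartedSpace (EuclideanSpace ℝ (Fin 4)) M] {f ν : M → EuclideanSpace ℝ (Fin 6)}
    (hν : (euclideanMetric (EuclideanSpace ℝ (Fin 6))).IsUnitNormal (𝓡 4) f ν 1) {x : M}
    (h5 : ν x 5 ^ 2 = 1) (i : Fin 5) : ν x (Fin.castSucc i) = 0 := by
  have hunit : ⟪ν x, ν x⟫ = (1 : ℝ) := by
    have h := hν.val_self x
    rwa [euclideanMetric_apply] at h
  have hsum : ‖ν x‖ ^ 2 = 1 := by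
    rw [← real_inner_self_eq_norm_sq, hunit]
  have hlast : (Fin.last 5 : Fin 6) = 5 := rfl
  rw [EuclideanSpace.real_norm_sq_eq, Fin.sum_univ_castSucc, hlast, h5] at hsum
  have h0 : ∑ j : Fin 5, ν x (Fin.castSucc j) ^ 2 = 0 := by linarith
  have hi := (Finset.sum_eq_zero_iff_of_nonneg fun j _ => sq_nonneg (ν x (Fin.castSucc j))).1 h0 i
    (Finset.mem_univ i)
  exact (pow_eq_zero_iff two_ne_zero).1 hi

/-- **Horizontal tangent planes: the differential has no height component.** If `ν` is a unit
normal field along `f : M → ℝ⁶` with `ν₅(x)² = 1`, then `(df_x v)₅ = 0` for every tangent vector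
`v ∈ T_x M`: normality `⟪ν x, df_x v⟫ = ∑ⱼ νⱼ(x) (df_x v)ⱼ = 0` reduces, by
`normal_castSucc_eq_zero_of_sq_eq_one`, to `ν₅(x) (df_x v)₅ = 0` with `ν₅(x) ≠ 0`. [folklore] -/
theorem mfderiv_apply_five_eq_zero_of_sq_eq_one {M : Type*} [TopologicalSpace M]
    [ChartedSpace (EuclideanSpace ℝ (Fin 4)) M] {f ν : M → EuclideanSpace ℝ (Fin 6)}
    (hν : (euclideanMetric (EuclideanSpace ℝ (Fin 6))).IsUnitNormal (𝓡 4) f ν 1) {x : M}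
    (h5 : ν x 5 ^ 2 = 1) (v : TangentSpace (𝓡 4) x) :
    WithLp.ofLp (mfderiv (𝓡 4) (𝓡 6) f x v) 5 = 0 := by
  set A : EuclideanSpace ℝ (Fin 4) →L[ℝ] EuclideanSpace ℝ (Fin 6) := mfderiv (𝓡 4) (𝓡 6) f x
  have hn : ⟪ν x, A v⟫ = (0 : ℝ) := hν.isNormalTo x v
  have hsum : ∑ j : Fin 6, ν x j * A v j = 0 := by
    rw [← hn]
    simp [PiLp.inner_apply, mul_comm]
  have hlast : (Fin.last 5 : Fin 6) = 5 := rfl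
  rw [Fin.sum_univ_castSucc, hlast] at hsum
  simp only [normal_castSucc_eq_zero_of_sq_eq_one hν h5, zero_mul, Finset.sum_const_zero,
    zero_add] at hsum
  have hν5 : ν x 5 ≠ 0 := fun h => by
    rw [h] at h5
    norm_num at h5
  exact (mul_eq_zero.1 hsum).resolve_left hν5

/-- **Registered helper `helper_heightConstOfHorizontal` of line `killing-flux` (rigidity layer
R1-A): a connected cross-section with horizontal tangent planes has constant height.** For a
connected `4`-manifold `M`, a smooth `f : M → ℝ⁶` and a unit normal field `ν` along `f` with
`ν₅(x)² = 1` for all `x`, the height `x ↦ f(x)₅` is constant: the smooth function `h = e₅^* ∘ f` has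
differential `dh_x = e₅^* ∘ df_x = 0` (`mfderiv_apply_five_eq_zero_of_sq_eq_one`, chain rule), and a
`C¹` function with vanishing differential on a connected manifold is constant
(`KarpukhinStern.apply_eq_of_mfderiv_eq_zero`). [folklore] -/
theorem helper_heightConstOfHorizontal :
    ∀ (M : Type) [TopologicalSpace M] [ChartedSpace (EuclideanSpace ℝ (Fin 4)) M] [IsManifold (𝓡 4) ∞ M]
      [ConnectedSpace M] (f ν : M → EuclideanSpace ℝ (Fin 6)),
      ContMDiff (𝓡 4) (𝓡 6) ∞ f →
      (Literature.Geometry.Riemannian.euclideanMetric (EuclideanSpace ℝ (Fin 6))).IsUnitNormal (𝓡 4) f ν 1 →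
      (∀ x, ν x 5 ^ 2 = 1) → ∀ x y : M, f x 5 = f y 5 := by
  intro M _ _ _ _ f ν hf hν h5 x y
  -- the height functional `e₅^*` and the height `h = e₅^* ∘ f`
  have hh : ContMDiff (𝓡 4) 𝓘(ℝ, ℝ) 1
      (⇑(EuclideanSpace.proj (5 : Fin 6) : EuclideanSpace ℝ (Fin 6) →L[ℝ] ℝ) ∘ f) :=
    ((EuclideanSpace.proj (5 : Fin 6) : EuclideanSpace ℝ (Fin 6) →L[ℝ] ℝ).contMDiff.comp hf).of_le
      (by exact_mod_cast le_top)
  have h0 : ∀ z, mfderiv (𝓡 4) 𝓘(ℝ, ℝ)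
      (⇑(EuclideanSpace.proj (5 : Fin 6) : EuclideanSpace ℝ (Fin 6) →L[ℝ] ℝ) ∘ f) z = 0 := by
    intro z
    have hfz : HasMFDerivAt (𝓡 4) (𝓡 6) f z (mfderiv (𝓡 4) (𝓡 6) f z) :=
      ((hf z).mdifferentiableAt (by simp)).hasMFDerivAt
    rw [((EuclideanSpace.proj (5 : Fin 6) : EuclideanSpace ℝ (Fin 6) →L[ℝ] ℝ).hasMFDerivAt.comp z
      hfz).mfderiv]
    refine ContinuousLinearMap.ext fun v => ?_
    rw [ContinuousLinearMap.comp_apply]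
    exact mfderiv_apply_five_eq_zero_of_sq_eq_one hν (h5 z) v
  exact KarpukhinStern.apply_eq_of_mfderiv_eq_zero (J := 𝓡 4) hh h0 x y

end Summit.SmoothPoincare4.SmoothPoincare4.Cruxes.CylinderRungTwo.KillingFlux

end
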